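import Summits.FinalStateConjecture.FinalStateConjecture.Theses.HomotheticSurfaceGravity

set_option linter.dupNamespace false

/-!
# Birth skeleton of piece A `VisibleEndlessObserver` (child of crux `NakedTangentProfile`, stmt-FinalStateConjecture-17353)

Two stubs and the real composition `VisibleEndlessObserver_of`:
* `stub_coherentWitness` — A COHERENT WITNESSING RAY: incomplete sojourn-`𝓘⁺` ⇒ exit ∨ ONE future-incomplete
  normalised null ray from the data whose own future half is visible from infinity (watched, up to its end, by the
  far witnessing rays: in the Rodnianski–Shlapentokh-Rothman picture every incoming far ray in a fixed direction is
  seen by the farther ones in that direction, all ending on the Cauchy horizon `C⁺(𝒪)`); geometric content = exterior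
  stability (Klainerman–Nicolò) + monotonicity of the far rays' ends along the visible future boundary.
* `stub_observerChasingRay` — AN ENDLESS OBSERVER CHASING AN INCOMPLETE RAY: in a maximal vacuum Cauchy development of
  admissible data, the chronological past of the future half of a future-incomplete normalised null ray contains a
  future-directed timelike curve without future endpoint (the TIP of the ray's ideal endpoint, Hawking–Ellis Prop.
  6.8.1 shape; uses global hyperbolicity: no incomplete inextendible geodesic is imprisoned near a point of `M`).
Composition: the observer of the second stub inside the past of the coherent ray of the first is visible because
pasts of visible sets are visible and visibility is antitone.
-/

namespace Summit.FinalStateConjecture.FinalStateConjecture.Cruxes.NakedTangentProfile.FirstNakedPointZorn.BirthA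

open Set Filter Function
open scoped Manifold ContDiff Topology
open Literature.Geometry.Lorentzian
open Summit.FinalStateConjecture.FinalStateConjecture.Theses.HomotheticSurfaceGravity

/-- **Stub A1 — a coherent witnessing ray.** -/
theorem stub_coherentWitness :
    ∀ (X : Type) [TopologicalSpace X] [ChartedSpace Literature.Geometry.Lorentzian.E3 X] [IsManifold (𝓡 3) ((⊤ : ℕ∞) : WithTop ℕ∞) X] [T2Space X] [SecondCountableTopology X] [ConnectedSpace X], ∀ D ∈ Literature.Geometry.Lorentzian.admissibleVacuumData X, ∀ 𝒟 : Literature.Geometry.Lorentzian.VacuumCauchyDevelopment D, 𝒟.IsMaximal → ¬ Summit.FinalStateConjecture.HasCompleteNullInfinity 𝒟.toCauchyDevelopment → (∃ (e : Literature.Geometry.Lorentzian.AFEnd X) (F : EuclideanSpace ℝ (Fin 1) → Literature.Geometry.Lorentzian.InitialDataSet (𝓡 3) X), Literature.Geometry.Lorentzian.InitialDataSet.IsTameDataFamily e 1 F ∧ Literature.Geometry.Lorentzian.InitialDataSet.IsImmersedAtZero 1 F ∧ F 0 = D ∧ Function.Injective F ∧ (∀ c, F c ∈ Literature.Geometry.Lorentzian.admissibleVacuumData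 X) ∧ ∃ ε : ℝ, 0 < ε ∧ ∀ c, c ≠ 0 → ‖c‖ < ε → ((∃ 𝒟' : Literature.Geometry.Lorentzian.VacuumCauchyDevelopment (F c), 𝒟'.IsMaximal) ∧ ∀ 𝒟' : Literature.Geometry.Lorentzian.VacuumCauchyDevelopment (F c), 𝒟'.IsMaximal → Summit.FinalStateConjecture.HasCompleteNullInfinity 𝒟'.toCauchyDevelopment ∧ ∃ (O : Set 𝒟'.carrier) (d : Literature.Geometry.Lorentzian.FinalStateDecomposition 𝒟'.toSpacetime O 2), (∀ i, Literature.Geometry.Lorentzian.Kerr.IsSubextremal (d.mass i) (d.spin i)) ∧ O = Summit.FinalStateConjecture.exteriorOf 𝒟'.toCauchyDevelopment d.charted ∧ Summit.FinalStateConjecture.RaysStayInClosure 𝒟'.toCauchyDevelopment O ∧ Summit.FinalStateConjecture.HasExhaustiveCharts d ∧ Summit.FinalStateConjecture.IsFutureOriented d)) ∨ ∃ (p : X) (γ : ℝ → 𝒟.carrier) (dom : Set ℝ), ∀ [𝒟.metric.HasLeviCivita], 𝒟.metric.IsNormalisedNullRayFrom 𝒟.timeOrientation 𝒟.embed 𝒟.normal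 p γ dom ∧ BddAbove dom ∧ 𝒟.metric.IsVisibleFromInfinity 𝒟.timeOrientation 𝒟.embed 𝒟.normal (γ '' (dom ∩ Set.Ici 0)) := by
  sorry

/-- **Stub A2 — an endless observer chasing an incomplete ray.** -/
theorem stub_observerChasingRay :
    ∀ (X : Type) [TopologicalSpace X] [ChartedSpace Literature.Geometry.Lorentzian.E3 X] [IsManifold (𝓡 3) ((⊤ : ℕ∞) : WithTop ℕ∞) X] [T2Space X] [SecondCountableTopology X] [ConnectedSpace X], ∀ D ∈ Literature.Geometry.Lorentzian.admissibleVacuumData X, ∀ 𝒟 : Literature.Geometry.Lorentzian.VacuumCauchyDevelopment D, 𝒟.IsMaximal → ∀ (p : X) (γ : ℝ → 𝒟.carrier) (dom : Set ℝ), (∀ [𝒟.metric.HasLeviCivita], 𝒟.metric.IsNormalisedNullRayFrom 𝒟.timeOrientation 𝒟.embed 𝒟.normal p γ dom) → BddAbove dom → ∃ (γ₀ : ℝ → 𝒟.carrier) (s₀ : Set ℝ), s₀.OrdConnected ∧ 𝒟.metric.IsFutureTimelikeCurveOn 𝒟.timeOrientation γ₀ s₀ ∧ Literature.Geometry.Lorentzian.IsFutureEndless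 γ₀ s₀ ∧ γ₀ '' s₀ ⊆ 𝒟.metric.chronologicalPast 𝒟.timeOrientation (γ '' (dom ∩ Set.Ici 0)) := by
  sorry

section Visibility

variable {E : Type*} [NormedAddCommGroup E] [NormedSpace ℝ E] {H : Type*} [TopologicalSpace H]
  {I : ModelWithCorners ℝ E H} {M : Type*} [TopologicalSpace M] [ChartedSpace H M]
  [IsManifold I ∞ M] {X : Type*} [TopologicalSpace X] {g : LorentzianMetric I ∞ M}
  {τ : TimeOrientation g} {ι : X → M} [FiniteDimensional ℝ E] [CompleteSpace E] [g.HasLeviCivita]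
  {N : NormalField I ι}

omit [CompleteSpace E] in
/-- The chronological past of a set visible from infinity is visible from infinity (pasts are
past sets; Hawking–Ellis 1973, §6.8, p. 217). -/
theorem isVisibleFromInfinity_chronologicalPast {P : Set M}
    (h : g.IsVisibleFromInfinity τ ι N P) :
    g.IsVisibleFromInfinity τ ι N (g.chronologicalPast τ P) := by
  intro B₀ hB₀
  obtain ⟨s, hs⟩ := h B₀ hB₀
  refine ⟨s, fun B₁ hB₁ ↦ ?_⟩
  obtain ⟨p, hp, γ, dom, hγ, hbdd, hsoj, hsub⟩ := hs B₁ hB₁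
  exact ⟨p, hp, γ, dom, hγ, hbdd, hsoj,
    (LorentzianMetric.chronologicalPast_mono hsub).trans
      (LorentzianMetric.isPastSet_chronologicalPast _)⟩

end Visibility

/-- **Piece A from its two stubs** (hypothesis form; no `sorry` here). -/
theorem visibleEndlessObserver_of_stubs :
    (∀ (X : Type) [TopologicalSpace X] [ChartedSpace Literature.Geometry.Lorentzian.E3 X] [IsManifold (𝓡 3) ((⊤ : ℕ∞) : WithTop ℕ∞) X] [T2Space X] [SecondCountableTopology X] [ConnectedSpace X], ∀ D ∈ Literature.Geometry.Lorentzian.admissibleVacuumData X, ∀ 𝒟 : Literature.Geometry.Lorentzian.VacuumCauchyDevelopment D, 𝒟.IsMaximal → ¬ Summit.FinalStateConjecture.HasCompleteNullInfinity 𝒟.toCauchyDevelopment → (∃ (e : Literature.Geometry.Lorentzian.AFEnd X) (F : EuclideanSpace ℝ (Fin 1) → Literature.Geometry.Lorentzian.InitialDataSet (𝓡 3) X), Literature.Geometry.Lorentzian.InitialDataSet.IsTameDataFamily e 1 F ∧ Literature.Geometry.Lorentzian.InitialDataSet.IsImmersedAtZero 1 F ∧ F 0 = D ∧ Function.Injective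 F ∧ (∀ c, F c ∈ Literature.Geometry.Lorentzian.admissibleVacuumData X) ∧ ∃ ε : ℝ, 0 < ε ∧ ∀ c, c ≠ 0 → ‖c‖ < ε → ((∃ 𝒟' : Literature.Geometry.Lorentzian.VacuumCauchyDevelopment (F c), 𝒟'.IsMaximal) ∧ ∀ 𝒟' : Literature.Geometry.Lorentzian.VacuumCauchyDevelopment (F c), 𝒟'.IsMaximal → Summit.FinalStateConjecture.HasCompleteNullInfinity 𝒟'.toCauchyDevelopment ∧ ∃ (O : Set 𝒟'.carrier) (d : Literature.Geometry.Lorentzian.FinalStateDecomposition 𝒟'.toSpacetime O 2), (∀ i, Literature.Geometry.Lorentzian.Kerr.IsSubextremal (d.mass i) (d.spin i)) ∧ O = Summit.FinalStateConjecture.exteriorOf 𝒟'.toCauchyDevelopment d.charted ∧ Summit.FinalStateConjecture.RaysStayInClosure 𝒟'.toCauchyDevelopment O ∧ Summit.FinalStateConjecture.HasExhaustiveCharts d ∧ Summit.FinalStateConjecture.IsFutureOriented d)) ∨ ∃ (p : X) (γ : ℝ → 𝒟.carrier) (dom : Set ℝ), ∀ [𝒟.metric.HasLeviCivita], 𝒟.metric.IsNormalisedNullRayFrom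 𝒟.timeOrientation 𝒟.embed 𝒟.normal p γ dom ∧ BddAbove dom ∧ 𝒟.metric.IsVisibleFromInfinity 𝒟.timeOrientation 𝒟.embed 𝒟.normal (γ '' (dom ∩ Set.Ici 0))) →
    (∀ (X : Type) [TopologicalSpace X] [ChartedSpace Literature.Geometry.Lorentzian.E3 X] [IsManifold (𝓡 3) ((⊤ : ℕ∞) : WithTop ℕ∞) X] [T2Space X] [SecondCountableTopology X] [ConnectedSpace X], ∀ D ∈ Literature.Geometry.Lorentzian.admissibleVacuumData X, ∀ 𝒟 : Literature.Geometry.Lorentzian.VacuumCauchyDevelopment D, 𝒟.IsMaximal → ∀ (p : X) (γ : ℝ → 𝒟.carrier) (dom : Set ℝ), (∀ [𝒟.metric.HasLeviCivita], 𝒟.metric.IsNormalisedNullRayFrom 𝒟.timeOrientation 𝒟.embed 𝒟.normal p γ dom) → BddAbove dom → ∃ (γ₀ : ℝ → 𝒟.carrier) (s₀ : Set ℝ), s₀.OrdConnected ∧ 𝒟.metric.IsFutureTimelikeCurveOn 𝒟.timeOrientation γ₀ s₀ ∧ Literature.Geometry.Lorentzian.IsFutureEndless γ₀ s₀ ∧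 γ₀ '' s₀ ⊆ 𝒟.metric.chronologicalPast 𝒟.timeOrientation (γ '' (dom ∩ Set.Ici 0))) →
    (∀ (X : Type) [TopologicalSpace X] [ChartedSpace Literature.Geometry.Lorentzian.E3 X] [IsManifold (𝓡 3) ((⊤ : ℕ∞) : WithTop ℕ∞) X] [T2Space X] [SecondCountableTopology X] [ConnectedSpace X], ∀ D ∈ Literature.Geometry.Lorentzian.admissibleVacuumData X, ∀ 𝒟 : Literature.Geometry.Lorentzian.VacuumCauchyDevelopment D, 𝒟.IsMaximal → ¬ Summit.FinalStateConjecture.HasCompleteNullInfinity 𝒟.toCauchyDevelopment → (∃ (e : Literature.Geometry.Lorentzian.AFEnd X) (F : EuclideanSpace ℝ (Fin 1) → Literature.Geometry.Lorentzian.InitialDataSet (𝓡 3) X), Literature.Geometry.Lorentzian.InitialDataSet.IsTameDataFamily e 1 F ∧ Literature.Geometry.Lorentzian.InitialDataSet.IsImmersedAtZero 1 F ∧ F 0 = D ∧ Function.Injective F ∧ (∀ c, F c ∈ Literature.Geometry.Lorentzian.admissibleVacuumData X) ∧ ∃ ε : ℝ, 0 < ε ∧ ∀ c, c ≠ 0 →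 ‖c‖ < ε → ((∃ 𝒟' : Literature.Geometry.Lorentzian.VacuumCauchyDevelopment (F c), 𝒟'.IsMaximal) ∧ ∀ 𝒟' : Literature.Geometry.Lorentzian.VacuumCauchyDevelopment (F c), 𝒟'.IsMaximal → Summit.FinalStateConjecture.HasCompleteNullInfinity 𝒟'.toCauchyDevelopment ∧ ∃ (O : Set 𝒟'.carrier) (d : Literature.Geometry.Lorentzian.FinalStateDecomposition 𝒟'.toSpacetime O 2), (∀ i, Literature.Geometry.Lorentzian.Kerr.IsSubextremal (d.mass i) (d.spin i)) ∧ O = Summit.FinalStateConjecture.exteriorOf 𝒟'.toCauchyDevelopment d.charted ∧ Summit.FinalStateConjecture.RaysStayInClosure 𝒟'.toCauchyDevelopment O ∧ Summit.FinalStateConjecture.HasExhaustiveCharts d ∧ Summit.FinalStateConjecture.IsFutureOriented d)) ∨ ∃ (γ₀ : ℝ → 𝒟.carrier) (s₀ : Set ℝ), s₀.OrdConnected ∧ 𝒟.metric.IsFutureTimelikeCurveOn 𝒟.timeOrientation γ₀ s₀ ∧ Literature.Geometry.Lorentzian.IsFutureEndless γ₀ s₀ ∧ ∀ [𝒟.metric.HasLeviCivita],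 𝒟.metric.IsVisibleFromInfinity 𝒟.timeOrientation 𝒟.embed 𝒟.normal (γ₀ '' s₀)) := by
  intro h1 h2 X _ _ _ _ _ _ D hD 𝒟 hmax hinc
  refine Classical.or_iff_not_imp_left.mpr fun hex ↦ ?_
  obtain ⟨p, γ, dom, hray⟩ := (h1 X D hD 𝒟 hmax hinc).resolve_left hex
  haveI hLC : 𝒟.metric.HasLeviCivita := 𝒟.metric.hasLeviCivita
  obtain ⟨hγ, hbdd, hvis⟩ := @hray hLC
  obtain ⟨γ₀, s₀, hs₀, hγ₀, he₀, hsub⟩ := h2 X D hD 𝒟 hmax p γ dom (fun {_} ↦ (@hray _).1) hbdd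
  exact ⟨γ₀, s₀, hs₀, hγ₀, he₀, fun {_} ↦ (isVisibleFromInfinity_chronologicalPast hvis).mono hsub⟩

/-- **Piece A by name from the registered stubs** (`sorry` only inside `stub_*`). -/
theorem VisibleEndlessObserver_of :
    (∀ (X : Type) [TopologicalSpace X] [ChartedSpace Literature.Geometry.Lorentzian.E3 X] [IsManifold (𝓡 3) ((⊤ : ℕ∞) : WithTop ℕ∞) X] [T2Space X] [SecondCountableTopology X] [ConnectedSpace X], ∀ D ∈ Literature.Geometry.Lorentzian.admissibleVacuumData X, ∀ 𝒟 : Literature.Geometry.Lorentzian.VacuumCauchyDevelopment D, 𝒟.IsMaximal → ¬ Summit.FinalStateConjecture.HasCompleteNullInfinity 𝒟.toCauchyDevelopment → (∃ (e : Literature.Geometry.Lorentzian.AFEnd X) (F : EuclideanSpace ℝ (Fin 1) → Literature.Geometry.Lorentzian.InitialDataSet (𝓡 3) X), Literature.Geometry.Lorentzian.InitialDataSet.IsTameDataFamily e 1 F ∧ Literature.Geometry.Lorentzian.InitialDataSet.IsImmersedAtZero 1 F ∧ F 0 = D ∧ Function.Injective F ∧ (∀ c, F c ∈ Literature.Geometry.Lorentzian.admissibleVacuumData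 X) ∧ ∃ ε : ℝ, 0 < ε ∧ ∀ c, c ≠ 0 → ‖c‖ < ε → ((∃ 𝒟' : Literature.Geometry.Lorentzian.VacuumCauchyDevelopment (F c), 𝒟'.IsMaximal) ∧ ∀ 𝒟' : Literature.Geometry.Lorentzian.VacuumCauchyDevelopment (F c), 𝒟'.IsMaximal → Summit.FinalStateConjecture.HasCompleteNullInfinity 𝒟'.toCauchyDevelopment ∧ ∃ (O : Set 𝒟'.carrier) (d : Literature.Geometry.Lorentzian.FinalStateDecomposition 𝒟'.toSpacetime O 2), (∀ i, Literature.Geometry.Lorentzian.Kerr.IsSubextremal (d.mass i) (d.spin i)) ∧ O = Summit.FinalStateConjecture.exteriorOf 𝒟'.toCauchyDevelopment d.charted ∧ Summit.FinalStateConjecture.RaysStayInClosure 𝒟'.toCauchyDevelopment O ∧ Summit.FinalStateConjecture.HasExhaustiveCharts d ∧ Summit.FinalStateConjecture.IsFutureOriented d)) ∨ ∃ (γ₀ : ℝ → 𝒟.carrier) (s₀ : Set ℝ), s₀.OrdConnected ∧ 𝒟.metric.IsFutureTimelikeCurveOn 𝒟.timeOrientation γ₀ s₀ ∧ Literature.Geometry.Lorentzian.IsFutureEndless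 γ₀ s₀ ∧ ∀ [𝒟.metric.HasLeviCivita], 𝒟.metric.IsVisibleFromInfinity 𝒟.timeOrientation 𝒟.embed 𝒟.normal (γ₀ '' s₀)) :=
  visibleEndlessObserver_of_stubs stub_coherentWitness stub_observerChasingRay

end Summit.FinalStateConjecture.FinalStateConjecture.Cruxes.NakedTangentProfile.FirstNakedPointZorn.BirthA
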